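import Summits.QuantumFields.GaugeBoot.DiagonalRPCutWitness
import HarnessLib

/-!
# The exact reflection-positivity integral against the cut witness (gauge-boot, L3(β) negative complement, part 2)

HONEST FRAMING (cell `pub-gaugeboot`, page 1 of every file): the venture produces certified bounds
on lattice expectations at stated coupling, gauge group, dimension and torus size; NOT a mass gap,
NOT a continuum limit, NOT a string tension; NOT Yang–Mills-summit-bearing (barriers
`FixedCouplingUltralocality`, `PerturbativeInvisibility`). The computation behind the NEGATIVE
structural result `DiagonalRPFiniteVolumeNegativeBeta.lean` (diagonal reflection positivity of
symmetric finite-volume Wilson states fails at every `β < 0`, for every gauge group).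

Setting of `DiagonalRPFiniteVolume.lean` / `DiagonalRPCutWitness.lean`: a swap-symmetric finite
link set `Λ ⊂ ℤ^d` containing the four links of a cut plaquette `p₀` of the mirror `x_i = x_j`, any
boundary condition `η`, `Q` the plaquettes touching `Λ`, `U = ζ η_{Λᶜ}` the glued configuration,
`F = cutWitness` the witness `χ_ρ(A_{p₀}(U)) e^{-β(A_Q(U) + M_Q(U)/2)}`. Then, for EVERY real `β` and
the scalar `c_β` of the one-link Wilson weight (`wAvg ρ w_β = c_β • 1`, scalar commutant):

* **`integral_weight_mul_cutWitness_eq`** —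
  `∫ e^{β ∑_Q Re tr ρ(U_p)} conj F(ΘU) F(U) dζ = c_β · P · W`, with
  `P = ∫ |χ_ρ(U(x₀,j) U(x₀+e_j,i))|² dζ > 0` (when `N ≥ 1`) and `W = ∫ ∏_{cut p ≠ p₀} w_β(U_p) dζ > 0`.

Proof: by `weight_mul_cutWitness` only the cut plaquettes weigh; distinct cut plaquettes have
disjoint links (`disjoint_plaquetteEdges_of_isCutPlaq`), so the `p₀`-factor and the rest are
independent under the product Haar measure (`LatticeRP.integral_mul_eq_of_dependsOn`); in the
`p₀`-factor the link `(x₀+e_i, j)` is integrated first (`LatticeRP.measurePreserving_splice`,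
`measurePreserving_eval`): by left and right invariance of Haar measure and the one-link identity
`∫ w_β(k) χ_ρ(k B) dk = c_β χ_ρ(B)` (`integral_weight_mul_trace_mul`, from
`TwistedSlabHaar.integral_weight_mul_entry`) it leaves `c_β |χ_ρ(B)|²`, `B = U(x₀,j) U(x₀+e_j,i)` the
mirror half. Everything is `[folklore]` (Fubini and invariance of Haar measure; no expansion).

References: K. Osterwalder, E. Seiler, Ann. Phys. 110 (1978) 440, §2; V. Kazakov, Z. Zheng,
arXiv:2404.16925 §3.2 (p. 10).
-/

noncomputable section

open MeasureTheory Complex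
open scoped ComplexOrder ComplexConjugate
open Literature.Probability.LatticeModels (Site box mem_box glueWith glueWith_apply_mem
  glueWith_apply_not_mem measurable_glueWith)
open Literature.MathematicalPhysics.QuantumLattice
open Literature.MathematicalPhysics.QuantumFieldTheory (haarProbability)
open Literature.MathematicalPhysics.QuantumFieldTheory.LatticeRP (integral_mul_eq_of_dependsOn
  integral_comp_eq_of_measurePreserving splice splice_apply measurePreserving_splice)
open Literature.RepresentationTheory.CompactGroups

namespace Summit.QuantumFields.GaugeBoot

namespace DiagRP

variable {d N : ℕ} {i j : Fin d} {G : Type*} [Group G] [TopologicalSpace G] [IsTopologicalGroup G]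
  [CompactSpace G] [MeasurableSpace G] [BorelSpace G] [SecondCountableTopology G]
variable (ρ : G →* Matrix (Fin N) (Fin N) ℂ)

/-! ## Two tools -/

omit [CompactSpace G] [MeasurableSpace G] [BorelSpace G] [SecondCountableTopology G] [Group G] in
/-- Gluing is continuous in the inside configuration. [folklore] -/
theorem continuous_glueWith (Λ : Finset (ZdEdge d)) (η : LGConfig d G) :
    Continuous fun ζ : ↥Λ → G => glueWith Λ ζ η :=
  (continuous_glueWith_prod Λ).comp (Continuous.prodMk_right η)

omit [SecondCountableTopology G] in
/-- **The one-link Haar average of a character**: `∫ w(k) χ_ρ(k B) dk = c · χ_ρ(B)` when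
`wAvg ρ w = c • 1`. [folklore] -/
theorem integral_weight_mul_trace_mul {w : G → ℝ} (hw : Continuous w) (hρ : Continuous ρ) {c : ℂ}
    (hc : TwistedSlab.wAvg ρ w = c • (1 : Matrix (Fin N) (Fin N) ℂ)) (B : G) :
    ∫ k, (w k : ℂ) * (ρ (k * B)).trace ∂(haarProbability G) = c * (ρ B).trace := by
  have hint : ∀ a s, Integrable (fun k => (w k : ℂ) * ρ k a s * ρ B s a) (haarProbability G) :=
    fun a s => ((TwistedSlab.continuous_weight_mul_entry ρ hw hρ a s).mul
      continuous_const).integrable_of_hasCompactSupport (HasCompactSupport.of_compactSpace _)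
  have h1 : ∀ k, (w k : ℂ) * (ρ (k * B)).trace = ∑ a, ∑ s, (w k : ℂ) * ρ k a s * ρ B s a := by
    intro k
    rw [map_mul, Matrix.trace, Finset.mul_sum]
    refine Finset.sum_congr rfl fun a _ => ?_
    rw [Matrix.diag_apply, Matrix.mul_apply, Finset.mul_sum]
    exact Finset.sum_congr rfl fun s _ => by ring
  simp_rw [h1]
  rw [integral_finsetSum _ fun a _ => integrable_finsetSum _ fun s _ => hint a s]
  simp_rw [integral_finsetSum _ fun s _ => hint _ s, integral_mul_const,
    TwistedSlab.integral_weight_mul_entry ρ hc]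
  rw [Matrix.trace, Finset.mul_sum]
  refine Finset.sum_congr rfl fun a _ => ?_
  simp [Matrix.diag_apply]

/-! ## The exact RP integral against the cut witness -/

section Main

variable {Λ : Finset (ZdEdge d)}

omit [Group G] [TopologicalSpace G] [IsTopologicalGroup G] [CompactSpace G] [MeasurableSpace G]
  [BorelSpace G] [SecondCountableTopology G] in
/-- The four named links of a cut plaquette are among its links. [folklore] -/
theorem mem_plaquetteEdges_of_isCutPlaq (hij : i ≠ j) {p : ZdPlaquette d} (hp : IsCutPlaq i j p) :
    (p.1, i) ∈ plaquetteEdges p ∧ (p.1 + Pi.single i 1, j) ∈ plaquetteEdges p ∧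
      (p.1 + Pi.single j 1, i) ∈ plaquetteEdges p ∧ (p.1, j) ∈ plaquetteEdges p := by
  obtain ⟨hk, hl⟩ := dirs_of_isCutPlaq hij hp
  have hlt : p.2.1.1 < p.2.1.2 := p.2.2
  simp only [mem_plaquetteEdges_iff]
  rcases hk with hk | hk <;> rcases hl with hl | hl
  · exact absurd (hk.trans hl.symm) (ne_of_lt hlt)
  · rw [hk, hl]; exact ⟨Or.inl rfl, Or.inr (Or.inl rfl), Or.inr (Or.inr (Or.inl rfl)), Or.inr (Or.inr (Or.inr rfl))⟩
  · rw [hk, hl]; exact ⟨Or.inr (Or.inr (Or.inr rfl)), Or.inr (Or.inr (Or.inl rfl)), Or.inr (Or.inl rfl), Or.inl rfl⟩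
  · exact absurd (hk.trans hl.symm) (ne_of_lt hlt)

omit [Group G] [TopologicalSpace G] [IsTopologicalGroup G] [CompactSpace G] [MeasurableSpace G]
  [BorelSpace G] [SecondCountableTopology G] in
/-- A cut plaquette whose links lie in `Λ` touches `Λ`. [folklore] -/
theorem mem_plaquettesTouching_of_subset (hij : i ≠ j) {p : ZdPlaquette d} (hp : IsCutPlaq i j p)
    (hsub : plaquetteEdges p ⊆ Λ) : p ∈ plaquettesTouching Λ :=
  mem_plaquettesTouching_iff.2 ⟨(p.1, i),
    Finset.mem_inter.2 ⟨(mem_plaquetteEdges_of_isCutPlaq hij hp).1,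
      hsub (mem_plaquetteEdges_of_isCutPlaq hij hp).1⟩⟩

/-- **THE EXACT RP INTEGRAL AGAINST THE CUT WITNESS.** `Λ` swap-symmetric containing the four links
of a cut plaquette `p₀`, any boundary condition `η`, any real `β`, `wAvg ρ w_β = c • 1`:
`∫ e^{β ∑_{Q} Re tr ρ(U_p)} conj F(ΘU) F(U) dζ = c · P · W` with
`P = ∫ |χ_ρ(U(x₀,j)U(x₀+e_j,i))|² dζ > 0` and `W = ∫ ∏_{cut p ≠ p₀} w_β(U_p) dζ > 0`
(`Q` the plaquettes touching `Λ`, `U = ζ η_{Λᶜ}`, `F = cutWitness`). [folklore] -/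
theorem integral_weight_mul_cutWitness_eq (hρ : Continuous ρ) (hij : i ≠ j)
    (hΛ : ∀ e ∈ Λ, edgeSwap i j e ∈ Λ) (η : LGConfig d G) {p₀ : ZdPlaquette d}
    (hp₀ : IsCutPlaq i j p₀) (hsub : plaquetteEdges p₀ ⊆ Λ) (β : ℝ) {c : ℝ}
    (hc : TwistedSlab.wAvg ρ (TwistedSlab.wilsonWeight ρ β) = ((c : ℂ)) • (1 : Matrix (Fin N) (Fin N) ℂ)) :
    ∃ P W : ℝ, 0 < W ∧ (0 < N → 0 < P) ∧
      ∫ ζ, (Real.exp (β * ∑ p ∈ plaquettesTouching Λ,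
          plaquetteObs ρ p.1 p.2.1.1 p.2.1.2 (glueWith Λ ζ η)) : ℂ) *
        (conj (cutWitness i j ρ β (plaquettesTouching Λ) p₀
            (configDiagSwapZd i j (glueWith Λ ζ η))) *
          cutWitness i j ρ β (plaquettesTouching Λ) p₀ (glueWith Λ ζ η))
        ∂(Measure.pi fun _ : ↥Λ => haarProbability G) = ((c * (P * W) : ℝ) : ℂ) := by
  classical
  haveI : IsProbabilityMeasure (haarProbability G) :=
    CompactGroup.isProbabilityMeasure_haarMeasure_top
  haveI : (haarProbability G).IsOpenPosMeasure := by unfold haarProbability; infer_instance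
  haveI : (Measure.pi fun _ : ↥Λ => haarProbability G).IsOpenPosMeasure := by infer_instance
  set Q := plaquettesTouching Λ with hQdef
  have hQ : ∀ p ∈ Q, plaqSwap i j p ∈ Q := fun p hp => plaqSwap_mem_plaquettesTouching hΛ hp
  have hp₀Q : p₀ ∈ Q.filter (IsCutPlaq i j) :=
    Finset.mem_filter.2 ⟨mem_plaquettesTouching_of_subset hij hp₀ hsub, hp₀⟩
  obtain ⟨he1, he2, he3, he4⟩ := mem_plaquetteEdges_of_isCutPlaq hij hp₀
  -- the four links as coordinates of `↥Λ`
  set e1 : ↥Λ := ⟨(p₀.1, i), hsub he1⟩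
  set e2 : ↥Λ := ⟨(p₀.1 + Pi.single i 1, j), hsub he2⟩
  set e3 : ↥Λ := ⟨(p₀.1 + Pi.single j 1, i), hsub he3⟩
  set e4 : ↥Λ := ⟨(p₀.1, j), hsub he4⟩
  have hw := TwistedSlab.continuous_wilsonWeight ρ hρ β
  have hglue := continuous_glueWith (G := G) Λ η
  have hΘc : Continuous (configDiagSwapZd (G := G) i j) :=
    continuous_pi fun e => continuous_apply _
  -- the two factors
  set f : (↥Λ → G) → ℂ := fun ζ => conj ((ρ (ζ e4 * ζ e3)).trace) * (ρ (ζ e1 * ζ e2)).trace *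
    (TwistedSlab.wilsonWeight ρ β (ζ e1 * ζ e2 * (ζ e4 * ζ e3)⁻¹) : ℂ) with hf
  set g : (↥Λ → G) → ℂ := fun ζ => ∏ p ∈ (Q.filter (IsCutPlaq i j)).erase p₀,
    (Real.exp (β * plaquetteObs ρ p.1 p.2.1.1 p.2.1.2 (glueWith Λ ζ η)) : ℂ) with hg
  -- Step 1: the integrand is `f * g`
  have hA : ∀ ζ, halfPlaq i j p₀ (glueWith Λ ζ η) = ζ e1 * ζ e2 := fun ζ => by
    simp only [halfPlaq, glueWith_apply_mem _ _ _ (hsub he1), glueWith_apply_mem _ _ _ (hsub he2), e1, e2]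
  have hB : ∀ ζ, halfPlaq i j p₀ (configDiagSwapZd i j (glueWith Λ ζ η)) = ζ e4 * ζ e3 := fun ζ => by
    rw [halfPlaq_configDiagSwapZd hp₀]
    simp only [glueWith_apply_mem _ _ _ (hsub he4), glueWith_apply_mem _ _ _ (hsub he3), e3, e4]
  have hfg : ∀ ζ, (Real.exp (β * ∑ p ∈ Q, plaquetteObs ρ p.1 p.2.1.1 p.2.1.2 (glueWith Λ ζ η)) : ℂ) *
      (conj (cutWitness i j ρ β Q p₀ (configDiagSwapZd i j (glueWith Λ ζ η))) *
        cutWitness i j ρ β Q p₀ (glueWith Λ ζ η)) = f ζ * g ζ := by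
    intro ζ
    rw [weight_mul_cutWitness ρ hρ hQ β p₀, ← Finset.mul_prod_erase _ _ hp₀Q,
      wilsonWeight_holonomy_of_isCutPlaq ρ hρ hij hp₀, cutObs, cutObs, hA, hB, hf, hg]
    simp only []
    rw [← mul_assoc]
    rfl
  -- Step 2: block structure
  set B0 : Finset ↥Λ := Finset.univ.filter fun e => (e : ZdEdge d) ∈ plaquetteEdges p₀ with hB0
  have hfdep : DependsOn f (B0 : Set ↥Λ) := by
    intro ζ ζ' h
    have hmem : ∀ e : ↥Λ, (e : ZdEdge d) ∈ plaquetteEdges p₀ → ζ e = ζ' e := fun e he =>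
      h e (by rw [hB0, Finset.coe_filter]; exact ⟨Finset.mem_univ _, he⟩)
    simp only [hf, hmem e1 he1, hmem e2 he2, hmem e3 he3, hmem e4 he4]
  have hgdep : DependsOn g ((B0ᶜ : Finset ↥Λ) : Set ↥Λ) := by
    intro ζ ζ' h
    simp only [hg]
    refine Finset.prod_congr rfl fun p hp => ?_
    have hp' := Finset.mem_erase.1 hp
    have hpcut : IsCutPlaq i j p := (Finset.mem_filter.1 hp'.2).2
    have hdisj := disjoint_plaquetteEdges_of_isCutPlaq hij hpcut hp₀ hp'.1
    rw [plaquetteObs_congr ρ p (V := glueWith Λ ζ' η) fun e he => ?_]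
    by_cases heΛ : e ∈ Λ
    · rw [glueWith_apply_mem _ _ _ heΛ, glueWith_apply_mem _ _ _ heΛ]
      refine h ⟨e, heΛ⟩ ?_
      rw [Finset.coe_compl, Set.mem_compl_iff, Finset.mem_coe, hB0, Finset.mem_filter]
      exact fun hm => Finset.disjoint_left.1 hdisj he hm.2
    · rw [glueWith_apply_not_mem _ _ _ heΛ, glueWith_apply_not_mem _ _ _ heΛ]
  have hfc : Continuous f := by
    have hev : ∀ e : ↥Λ, Continuous fun ζ : ↥Λ → G => ζ e := fun e => continuous_apply e
    refine ((continuous_conj.comp (hρ.comp ((hev e4).mul (hev e3))).matrix_trace).mul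
      (hρ.comp ((hev e1).mul (hev e2))).matrix_trace).mul (continuous_ofReal.comp (hw.comp ?_))
    exact ((hev e1).mul (hev e2)).mul ((hev e4).mul (hev e3)).inv
  have hgc : Continuous g := by
    refine continuous_finsetProd _ fun p _ => continuous_ofReal.comp (Real.continuous_exp.comp
      (continuous_const.mul ((continuous_plaquetteObs ρ hρ _ _ _).comp hglue)))
  have hsplit : ∫ ζ, f ζ * g ζ ∂(Measure.pi fun _ : ↥Λ => haarProbability G) =
      (∫ ζ, f ζ ∂(Measure.pi fun _ : ↥Λ => haarProbability G)) *
        ∫ ζ, g ζ ∂(Measure.pi fun _ : ↥Λ => haarProbability G) :=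
    integral_mul_eq_of_dependsOn (haarProbability G) B0 B0ᶜ disjoint_compl_right hfc.measurable
      hgc.measurable hfdep hgdep
  -- Step 3: the `g` factor is a positive real
  set W : ℝ := ∫ ζ, ∏ p ∈ (Q.filter (IsCutPlaq i j)).erase p₀,
    Real.exp (β * plaquetteObs ρ p.1 p.2.1.1 p.2.1.2 (glueWith Λ ζ η))
      ∂(Measure.pi fun _ : ↥Λ => haarProbability G) with hW
  have hgW : ∫ ζ, g ζ ∂(Measure.pi fun _ : ↥Λ => haarProbability G) = (W : ℂ) := by
    rw [hW, ← integral_complex_ofReal]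
    refine integral_congr_ae (ae_of_all _ fun ζ => ?_)
    simp only [hg, Complex.ofReal_prod]
  have hWc : Continuous fun ζ : ↥Λ → G => ∏ p ∈ (Q.filter (IsCutPlaq i j)).erase p₀,
      Real.exp (β * plaquetteObs ρ p.1 p.2.1.1 p.2.1.2 (glueWith Λ ζ η)) :=
    continuous_finsetProd _ fun p _ => Real.continuous_exp.comp
      (continuous_const.mul ((continuous_plaquetteObs ρ hρ _ _ _).comp hglue))
  have hWpos : 0 < W := by
    rw [hW, integral_pos_iff_support_of_nonneg (fun ζ => Finset.prod_nonneg fun p _ =>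
      (Real.exp_pos _).le) (hWc.integrable_of_hasCompactSupport (HasCompactSupport.of_compactSpace _))]
    have : (Function.support fun ζ : ↥Λ → G => ∏ p ∈ (Q.filter (IsCutPlaq i j)).erase p₀,
        Real.exp (β * plaquetteObs ρ p.1 p.2.1.1 p.2.1.2 (glueWith Λ ζ η))) = Set.univ :=
      Set.eq_univ_of_forall fun ζ => (Finset.prod_pos fun p _ => Real.exp_pos _).ne'
    rw [this, measure_univ]; exact one_pos
  -- Step 4: the `f` factor, by one-link Haar integration over `e2`
  set P : ℝ := ∫ ζ, ‖(ρ (ζ e4 * ζ e3)).trace‖ ^ 2 ∂(Measure.pi fun _ : ↥Λ => haarProbability G) with hP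
  have he21 : e1 ≠ e2 := fun h => by
    have := congrArg (fun e : ↥Λ => (e : ZdEdge d).2) h; exact hij (by simpa [e1, e2] using this)
  have he23 : e3 ≠ e2 := fun h => by
    have := congrArg (fun e : ↥Λ => (e : ZdEdge d).2) h; exact hij (by simpa [e2, e3] using this)
  have he24 : e4 ≠ e2 := fun h => by
    have := congrArg (fun e : ↥Λ => (e : ZdEdge d).1 i) h
    simp [e2, e4] at this
  have hinner : ∀ B g1 : G, ∫ y, (ρ (g1 * y)).trace *
      (TwistedSlab.wilsonWeight ρ β (g1 * y * B⁻¹) : ℂ) ∂(haarProbability G) = c * (ρ B).trace := by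
    intro B g1
    have h1 := integral_mul_left_eq_self (μ := haarProbability G)
      (fun y => (ρ y).trace * (TwistedSlab.wilsonWeight ρ β (y * B⁻¹) : ℂ)) g1
    rw [h1]
    have h2 := integral_mul_right_eq_self (μ := haarProbability G)
      (fun y => (ρ y).trace * (TwistedSlab.wilsonWeight ρ β (y * B⁻¹) : ℂ)) B
    simp only [mul_inv_cancel_right] at h2
    rw [← h2]
    simp_rw [mul_comm ((ρ (_ * B)).trace)]
    exact integral_weight_mul_trace_mul ρ hw hρ hc B
  have hfsplice : ∀ ζ Y : ↥Λ → G, f (splice {e2} (ζ, Y)) =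
      conj ((ρ (ζ e4 * ζ e3)).trace) * ((ρ (ζ e1 * Y e2)).trace *
        (TwistedSlab.wilsonWeight ρ β (ζ e1 * Y e2 * (ζ e4 * ζ e3)⁻¹) : ℂ)) := by
    intro ζ Y
    simp only [hf, splice_apply, Finset.mem_singleton, if_true, if_neg he21, if_neg he23,
      if_neg he24, mul_assoc]
  have hfI : ∫ ζ, f ζ ∂(Measure.pi fun _ : ↥Λ => haarProbability G) = (c : ℂ) * (P : ℂ) := by
    have hsp := measurePreserving_splice (haarProbability G) ({e2} : Finset ↥Λ)
    have hsplc : Continuous (splice (G := G) ({e2} : Finset ↥Λ)) := by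
      refine continuous_pi fun t => ?_
      by_cases ht : t ∈ ({e2} : Finset ↥Λ)
      · simp only [splice_apply, ht, if_true]
        exact (continuous_apply t).comp continuous_snd
      · simp only [splice_apply, ht, if_false]
        exact (continuous_apply t).comp continuous_fst
    rw [← integral_comp_eq_of_measurePreserving hsp hfc.measurable,
      integral_prod (fun z => f (splice ({e2} : Finset ↥Λ) z))
        ((hfc.comp hsplc).integrable_of_hasCompactSupport (HasCompactSupport.of_compactSpace _))]
    have hin : ∀ ζ : ↥Λ → G, ∫ Y, f (splice {e2} (ζ, Y)) ∂(Measure.pi fun _ : ↥Λ => haarProbability G)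
        = (c : ℂ) * ((‖(ρ (ζ e4 * ζ e3)).trace‖ ^ 2 : ℝ) : ℂ) := by
      intro ζ
      simp_rw [hfsplice ζ]
      rw [integral_const_mul]
      have hev := MeasureTheory.measurePreserving_eval (μ := fun _ : ↥Λ => haarProbability G) e2
      have hφm : Measurable fun y : G => (ρ (ζ e1 * y)).trace *
          (TwistedSlab.wilsonWeight ρ β (ζ e1 * y * (ζ e4 * ζ e3)⁻¹) : ℂ) :=
        ((hρ.comp (continuous_const.mul continuous_id)).matrix_trace.mul
          (continuous_ofReal.comp (hw.comp ((continuous_const.mul continuous_id).mul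
            continuous_const)))).measurable
      have h3 := integral_comp_eq_of_measurePreserving hev hφm
      simp only [Function.eval] at h3
      rw [h3, hinner, ← mul_assoc, mul_comm (conj _) (c : ℂ), mul_assoc, Complex.conj_mul',
        Complex.ofReal_pow]
    simp_rw [hin]
    rw [integral_const_mul, integral_complex_ofReal]
  have hPc : Continuous fun ζ : ↥Λ → G => ‖(ρ (ζ e4 * ζ e3)).trace‖ ^ 2 :=
    ((hρ.comp ((continuous_apply e4).mul (continuous_apply e3))).matrix_trace).norm.pow 2
  have hPpos : 0 < N → 0 < P := by
    intro hN
    rw [hP, integral_pos_iff_support_of_nonneg (fun ζ => sq_nonneg _)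
      (hPc.integrable_of_hasCompactSupport (HasCompactSupport.of_compactSpace _))]
    have hopen : IsOpen {ζ : ↥Λ → G | 0 < ‖(ρ (ζ e4 * ζ e3)).trace‖ ^ 2} :=
      isOpen_lt continuous_const hPc
    have hone : (fun _ => (1 : G)) ∈ {ζ : ↥Λ → G | 0 < ‖(ρ (ζ e4 * ζ e3)).trace‖ ^ 2} := by
      show 0 < ‖(ρ ((1 : G) * 1)).trace‖ ^ 2
      rw [mul_one, map_one, Matrix.trace_one, Fintype.card_fin, Complex.norm_natCast]
      have : (0 : ℝ) < N := by exact_mod_cast hN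
      positivity
    refine lt_of_lt_of_le (hopen.measure_pos _ ⟨_, hone⟩) (measure_mono fun ζ hζ => ?_)
    rw [Function.mem_support]
    exact ne_of_gt hζ
  refine ⟨P, W, hWpos, hPpos, ?_⟩
  simp_rw [hfg]
  rw [hsplit, hfI, hgW]
  push_cast
  ring

end Main

end DiagRP

end Summit.QuantumFields.GaugeBoot

end
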